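import Mathlib.Analysis.SpecialFunctions.OrdinaryHypergeometric
import Mathlib.Analysis.SpecialFunctions.Log.Deriv
import Mathlib.Analysis.Complex.Basic
import HarnessLib

/-!
# Rohde–Schramm's hypergeometric function `Ĝ_{a,κ}` (Lemma 6.3) and its growth for `κ ≥ 8`

Trunk T-STOCH; layer 4b (special functions) of the decomposition of the space-filling phase of
SLE_κ (`Literature.Probability.RandomPlanarGeometry.ae_isSpaceFilling_sleTrace_of_eight_le`; Rohde–Schramm, Ann. Math. 161
(2005), Cor. 7.4 + Update), serving its remaining stochastic input **Lemma 6.3, `κ ≥ 8`**.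
Rohde–Schramm (2005), p. 903, eq. (6.1) and the display before Lemma 6.3:

* `₂F₁(η₀, η₁, η₂, z) = Σₙ (η₀)ₙ (η₁)ₙ / ((η₂)ₙ n!) zⁿ` — Mathlib's `ordinaryHypergeometric` (`₂F₁`);
* `Ĝ_{a,κ}(x + iy) := ₂F₁(η₀, η₁, 1/2, x²/(x² + y²))`, `ηⱼ(a, κ) = 1/2 - 2/κ - (-1)ʲ √(32aκ +
  (2κ-8)²)/(4κ)` — here `Literature.Probability.RandomPlanarGeometry.rsEta₀`, `Literature.Probability.RandomPlanarGeometry.rsEta₁`, `Literature.Probability.RandomPlanarGeometry.rsGhat`.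

The proof of Lemma 6.3 for `κ ≥ 8` (pp. 905–906) uses an exponent `a < 0` for which
`Ĝ_{a,κ}(1) = lim_{s→∞} Ĝ_{a,κ}(s + i) = ∞`: for `κ > 8` the printed choice is `a = 1 - κ/8`
(`Ĝ = (y/|z|)^{(8-κ)/κ}`), for `κ = 8` it is the function `₂F₁(1/4, 1/4, 1/2, ·)`, i.e. `η₀ = η₁ =
1/4`, whose coefficients `aₙ` have "`n aₙ` bounded away from zero" (p. 906). We use, uniformly in
`κ ≥ 8`, the exponent with `η₀ = η₁` (vanishing discriminant):

* `Literature.rsExponent κ = -(κ-4)²/(8κ)` (`= -1/4` at `κ = 8`), for which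
  `η₀ = η₁ = η(κ) := 1/2 - 2/κ ∈ [1/4, 1/2)` (`rsEta₀_rsExponent`, `rsEta₁_rsExponent`) and
  `Ĝ_{a,κ}(z) = ₂F₁(η, η, 1/2, w²/(1+w²))`, `w = x/y` (`rsGhat_rsExponent_eq`);
* for `1/4 ≤ η ≤ 1/2` the coefficients `cₙ = (η)ₙ²/((1/2)ₙ n!)` of `₂F₁(η, η, 1/2, ·)` satisfy
  `0 < cₙ ≤ 1` and **`n cₙ ≥ 2η²`** (the printed coefficient estimate: `(n+1)c_{n+1} = n cₙ bₙ`,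
  `bₙ = (n+η)²/(n(n+1/2)) ≥ 1`), whence on `[0, 1)` the function is `≥ 1`, non-decreasing, and
  **`₂F₁(η, η, 1/2, r) ≥ 1 + 2η² (-log(1-r)) → ∞` as `r ↑ 1`** (`hypHalf_ge`), i.e.
  `Ĝ(s + i) ≥ 1 + 2η² log(1 + s²) → ∞` (`rsGhatW_ge_log`, `tendsto_rsGhatW_atTop`) — the
  statement "`Ĝ(1) = ∞`" of p. 905–906 for this exponent.

All statements here are elementary real analysis, proved from Mathlib (`ordinaryHypergeometric`,
`ascPochhammer`, `Real.hasSum_pow_div_log_of_abs_lt_one`).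

## References

* S. Rohde, O. Schramm, *Basic properties of SLE*, Ann. of Math. 161 (2005) 883–924: eq. (6.1),
  the definition of `Ĝ_{a,κ}` and `ηⱼ` (p. 903), proof of Lemma 6.3 (pp. 905–906).
-/

noncomputable section

open Set Filter Topology Finset
open scoped NNReal

namespace Literature.Probability.RandomPlanarGeometry

/-! ### The parameters `η₀, η₁`, the function `Ĝ_{a,κ}`, and the exponent with `η₀ = η₁` -/

/-- Rohde–Schramm's **`η₀(a, κ) = 1/2 - 2/κ - √(32aκ + (2κ-8)²)/(4κ)`** (p. 903; real square root,
junk `√` of a negative discriminant is `0`). [cite: RohdeSchramm2005, Lemma 6.3] -/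
def rsEta₀ (a κ : ℝ) : ℝ :=
  1 / 2 - 2 / κ - Real.sqrt (32 * a * κ + (2 * κ - 8) ^ 2) / (4 * κ)

/-- Rohde–Schramm's **`η₁(a, κ) = 1/2 - 2/κ + √(32aκ + (2κ-8)²)/(4κ)`** (p. 903).
[cite: RohdeSchramm2005, Lemma 6.3] -/
def rsEta₁ (a κ : ℝ) : ℝ :=
  1 / 2 - 2 / κ + Real.sqrt (32 * a * κ + (2 * κ - 8) ^ 2) / (4 * κ)

/-- Rohde–Schramm's **`Ĝ_{a,κ}(x + iy) := ₂F₁(η₀, η₁, 1/2, x²/(x² + y²))`** (p. 903), with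
Mathlib's ordinary hypergeometric function `₂F₁` over `ℝ` (eq. (6.1); the argument lies in
`[0, 1)` for `y ≠ 0`, inside the disc of convergence). [cite: RohdeSchramm2005, Lemma 6.3] -/
def rsGhat (a κ : ℝ) (z : ℂ) : ℝ :=
  ₂F₁ (rsEta₀ a κ) (rsEta₁ a κ) (1 / 2 : ℝ) (z.re ^ 2 / (z.re ^ 2 + z.im ^ 2))

/-- **The exponent `a(κ) := -(κ-4)²/(8κ)`**, the value of `a` at which the discriminant
`32aκ + (2κ-8)²` vanishes, so that `η₀ = η₁ = 1/2 - 2/κ`; at `κ = 8` it is `-1/4` and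
`Ĝ_{a,8} = ₂F₁(1/4, 1/4, 1/2, ·)`, the function used by Rohde–Schramm for `κ = 8` (p. 905–906:
"if `aₙ` denotes the `n`-th coefficient of `₂F₁(1/4, 1/4, 1/2, z)` …"; the subscript printed
there reads `Ĝ_{1/4,8}`, but `η₀ = η₁ = 1/4` at `κ = 8` and the row "`a < 0, κ ≥ 8`" of the
lemma, which is the one yielding `Z = ∞`, fix the sign `a = -1/4`).
[cite: RohdeSchramm2005, Lemma 6.3] -/
def rsExponent (κ : ℝ) : ℝ :=
  -(κ - 4) ^ 2 / (8 * κ)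

/-- **`η(κ) := 1/2 - 2/κ`**, the common value of `η₀, η₁` at the exponent `rsExponent κ`.
[cite: RohdeSchramm2005, Lemma 6.3] -/
def rsEta (κ : ℝ) : ℝ :=
  1 / 2 - 2 / κ

/-- The discriminant vanishes at `a = rsExponent κ`. [folklore] -/
theorem discr_rsExponent {κ : ℝ} (hκ : κ ≠ 0) :
    32 * rsExponent κ * κ + (2 * κ - 8) ^ 2 = 0 := by
  rw [rsExponent]
  field_simp
  ring

/-- `η₀(a(κ), κ) = 1/2 - 2/κ`. [folklore] -/
theorem rsEta₀_rsExponent {κ : ℝ} (hκ : κ ≠ 0) : rsEta₀ (rsExponent κ) κ = rsEta κ := by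
  rw [rsEta₀, discr_rsExponent hκ, Real.sqrt_zero, zero_div, sub_zero, rsEta]

/-- `η₁(a(κ), κ) = 1/2 - 2/κ`. [folklore] -/
theorem rsEta₁_rsExponent {κ : ℝ} (hκ : κ ≠ 0) : rsEta₁ (rsExponent κ) κ = rsEta κ := by
  rw [rsEta₁, discr_rsExponent hκ, Real.sqrt_zero, zero_div, add_zero, rsEta]

/-- `a(κ) < 0` for `κ > 0`, `κ ≠ 4`. [folklore] -/
theorem rsExponent_neg {κ : ℝ} (hκ : 0 < κ) (hκ4 : κ ≠ 4) : rsExponent κ < 0 := by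
  have h4 : κ - 4 ≠ 0 := sub_ne_zero.2 hκ4
  have hsq : 0 < (κ - 4) ^ 2 := by positivity
  rw [rsExponent, neg_div]
  exact neg_neg_of_pos (div_pos hsq (by positivity))

/-- `a(8) = -1/4`. [folklore] -/
theorem rsExponent_eight : rsExponent 8 = -1 / 4 := by
  rw [rsExponent]; norm_num

/-- `η(8) = 1/4`. [folklore] -/
theorem rsEta_eight : rsEta 8 = 1 / 4 := by
  rw [rsEta]; norm_num

/-- For `κ ≥ 8`, `1/4 ≤ η(κ)`. [folklore] -/
theorem one_quarter_le_rsEta {κ : ℝ} (hκ : 8 ≤ κ) : 1 / 4 ≤ rsEta κ := by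
  rw [rsEta]
  have hκ0 : 0 < κ := by linarith
  rw [show (1:ℝ)/4 = 1/2 - 2/8 by norm_num]
  gcongr

/-- `η(κ) < 1/2` for `κ > 0`. [folklore] -/
theorem rsEta_lt_half {κ : ℝ} (hκ : 0 < κ) : rsEta κ < 1 / 2 := by
  rw [rsEta]
  have : 0 < 2 / κ := by positivity
  linarith

/-- `x²/(x²+y²) = w²/(1+w²)` with `w = x/y`, `y ≠ 0`. [folklore] -/
theorem re_sq_div_eq {Z : ℂ} (hZ : Z.im ≠ 0) :
    Z.re ^ 2 / (Z.re ^ 2 + Z.im ^ 2) = (Z.re / Z.im) ^ 2 / (1 + (Z.re / Z.im) ^ 2) := by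
  have h1 : Z.re ^ 2 + Z.im ^ 2 ≠ 0 := by positivity
  field_simp
  ring

/-! ### The hypergeometric function `₂F₁(η, η, 1/2, ·)` on `[0, 1)` -/

section HypHalf

variable (η : ℝ)

/-- The coefficients `cₙ = (η)ₙ (η)ₙ / ((1/2)ₙ n!)` of `₂F₁(η, η, 1/2, ·)` (Mathlib's
`ordinaryHypergeometricCoefficient`). [folklore] -/
def hypHalfCoeff (n : ℕ) : ℝ :=
  ordinaryHypergeometricCoefficient η η (1 / 2 : ℝ) n

/-- `c₀ = 1`. [folklore] -/
theorem hypHalfCoeff_zero : hypHalfCoeff η 0 = 1 := by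
  simp [hypHalfCoeff, ordinaryHypergeometricCoefficient]

/-- **The coefficient recursion** `c_{n+1} = cₙ (η+n)² / ((1/2+n)(n+1))` (Rohde–Schramm (2005),
p. 906: `(n+1) a_{n+1} = n aₙ bₙ`, `bₙ = (n+1/4)²/(n(n+1/2))` for `η = 1/4`). [folklore] -/
theorem hypHalfCoeff_succ (n : ℕ) :
    hypHalfCoeff η (n + 1) = hypHalfCoeff η n * ((η + n) ^ 2 / ((1 / 2 + n) * (n + 1))) := by
  have hP : (ascPochhammer ℝ n).eval (1 / 2 : ℝ) ≠ 0 :=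
    (ascPochhammer_pos n (1 / 2 : ℝ) (by norm_num)).ne'
  have h1 : (1 / 2 + (n : ℝ)) ≠ 0 := by positivity
  have h2 : ((n : ℝ) + 1) ≠ 0 := by positivity
  have h3 : ((n.factorial : ℕ) : ℝ) ≠ 0 := by positivity
  unfold hypHalfCoeff ordinaryHypergeometricCoefficient
  rw [ascPochhammer_succ_eval, ascPochhammer_succ_eval, Nat.factorial_succ, Nat.cast_mul,
    Nat.cast_succ]
  field_simp

/-- `0 < cₙ` for `η > 0`. [folklore] -/
theorem hypHalfCoeff_pos {η : ℝ} (hη : 0 < η) (n : ℕ) : 0 < hypHalfCoeff η n := by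
  induction n with
  | zero => rw [hypHalfCoeff_zero]; exact one_pos
  | succ n ih =>
    rw [hypHalfCoeff_succ]
    refine mul_pos ih (div_pos ?_ ?_) <;> positivity

/-- `cₙ ≤ 1` for `0 < η ≤ 1/2` (each factor `(η+n)²/((1/2+n)(n+1)) ≤ 1`). [folklore] -/
theorem hypHalfCoeff_le_one {η : ℝ} (hη : 0 < η) (hη' : η ≤ 1 / 2) (n : ℕ) :
    hypHalfCoeff η n ≤ 1 := by
  induction n with
  | zero => rw [hypHalfCoeff_zero]
  | succ n ih =>
    rw [hypHalfCoeff_succ]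
    have hpos := hypHalfCoeff_pos hη n
    have hfac : (η + n) ^ 2 / ((1 / 2 + n) * (n + 1)) ≤ 1 := by
      rw [div_le_one (by positivity), pow_two]
      have hn : (0 : ℝ) ≤ n := n.cast_nonneg
      apply mul_le_mul <;> nlinarith
    calc hypHalfCoeff η n * ((η + n) ^ 2 / ((1 / 2 + n) * (n + 1)))
        ≤ 1 * 1 := mul_le_mul ih hfac (by positivity) zero_le_one
      _ = 1 := one_mul _

/-- **The coefficient estimate `n cₙ ≥ 2η²` for `n ≥ 1`, when `η ≥ 1/4`** (Rohde–Schramm (2005),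
p. 906: "it follows from `bₙ ≥ 1`… that `n aₙ` is bounded away from zero"; here
`(n+η)² ≥ n(n+1/2)` iff `2ηn + η² ≥ n/2`, true for `η ≥ 1/4`). [cite: RohdeSchramm2005, Lemma 6.3] -/
theorem mul_hypHalfCoeff_ge {η : ℝ} (hη : 1 / 4 ≤ η) (n : ℕ) (hn : 1 ≤ n) :
    2 * η ^ 2 ≤ n * hypHalfCoeff η n := by
  have hη0 : 0 < η := by linarith
  induction n, hn using Nat.le_induction with
  | base =>
    rw [Nat.cast_one, one_mul, hypHalfCoeff_succ, hypHalfCoeff_zero, Nat.cast_zero]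
    apply le_of_eq
    field_simp
    ring
  | succ n hn ih =>
    rw [hypHalfCoeff_succ, Nat.cast_succ]
    have hpos := hypHalfCoeff_pos hη0 n
    have hn' : (1 : ℝ) ≤ n := by exact_mod_cast hn
    -- `(n+1) c_{n+1} = n cₙ · (η+n)² / (n (1/2+n)) ≥ n cₙ`
    have hkey : (n : ℝ) * hypHalfCoeff η n ≤
        (n + 1) * (hypHalfCoeff η n * ((η + n) ^ 2 / ((1 / 2 + n) * (n + 1)))) := by
      rw [show (n + 1 : ℝ) * (hypHalfCoeff η n * ((η + n) ^ 2 / ((1 / 2 + n) * (n + 1)))) =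
        hypHalfCoeff η n * ((η + n) ^ 2 / (1 / 2 + n)) by field_simp]
      rw [mul_comm (n : ℝ)]
      refine mul_le_mul_of_nonneg_left ?_ hpos.le
      rw [le_div_iff₀ (by positivity)]
      nlinarith
    exact ih.trans hkey

variable {η}

/-- **Power series of `₂F₁(η, η, 1/2, r)` on `[0, 1)`**: `HasSum (cₙ rⁿ) (₂F₁ η η (1/2) r)` for
`0 < η ≤ 1/2`, `0 ≤ r < 1` (comparison with the geometric series, `cₙ ≤ 1`; eq. (6.1)).
[cite: RohdeSchramm2005, Lemma 6.3] -/
theorem hasSum_hypHalf (hη : 0 < η) (hη' : η ≤ 1 / 2) {r : ℝ} (hr0 : 0 ≤ r) (hr : r < 1) :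
    HasSum (fun n ↦ hypHalfCoeff η n * r ^ n) (₂F₁ η η (1 / 2 : ℝ) r) := by
  have hsum : Summable fun n ↦ hypHalfCoeff η n * r ^ n := by
    refine Summable.of_nonneg_of_le (fun n ↦ ?_) (fun n ↦ ?_) (summable_geometric_of_lt_one hr0 hr)
    · exact mul_nonneg (hypHalfCoeff_pos hη n).le (pow_nonneg hr0 n)
    · exact mul_le_of_le_one_left (pow_nonneg hr0 n) (hypHalfCoeff_le_one hη hη' n)
  have heq : ₂F₁ η η (1 / 2 : ℝ) r = ∑' n, hypHalfCoeff η n * r ^ n := by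
    rw [ordinaryHypergeometric_eq_tsum]
    simp only [smul_eq_mul, hypHalfCoeff, ordinaryHypergeometricCoefficient]
  rw [heq]
  exact hsum.hasSum

/-- `1 ≤ ₂F₁(η, η, 1/2, r)` on `[0, 1)` (`0 < η ≤ 1/2`; all terms are `≥ 0`, the first is `1`).
[folklore] -/
theorem one_le_hypHalf (hη : 0 < η) (hη' : η ≤ 1 / 2) {r : ℝ} (hr0 : 0 ≤ r) (hr : r < 1) :
    1 ≤ ₂F₁ η η (1 / 2 : ℝ) r := by
  have h := sum_le_hasSum {0} (fun n _ ↦ mul_nonneg (hypHalfCoeff_pos hη n).le (pow_nonneg hr0 n))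
    (hasSum_hypHalf hη hη' hr0 hr)
  simpa [hypHalfCoeff_zero] using h

/-- `₂F₁(η, η, 1/2, ·)` is non-decreasing on `[0, 1)` (`0 < η ≤ 1/2`; non-negative coefficients).
[folklore] -/
theorem hypHalf_mono (hη : 0 < η) (hη' : η ≤ 1 / 2) {r r' : ℝ} (hr0 : 0 ≤ r) (hrr' : r ≤ r')
    (hr' : r' < 1) : ₂F₁ η η (1 / 2 : ℝ) r ≤ ₂F₁ η η (1 / 2 : ℝ) r' :=
  hasSum_le (fun n ↦ mul_le_mul_of_nonneg_left (pow_le_pow_left₀ hr0 hrr' n)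
    (hypHalfCoeff_pos hη n).le) (hasSum_hypHalf hη hη' hr0 (hrr'.trans_lt hr'))
    (hasSum_hypHalf hη hη' (hr0.trans hrr') hr')

/-- **Logarithmic growth: `₂F₁(η, η, 1/2, r) ≥ 1 + 2η² (-log(1 - r))`** on `[0, 1)` for
`1/4 ≤ η ≤ 1/2` (from `cₙ ≥ 2η²/n`, `n ≥ 1`, and `Σ_{n≥1} rⁿ/n = -log(1-r)`); in particular
`₂F₁(η, η, 1/2, r) → ∞` as `r ↑ 1` — the divergence "`Ĝ(1) = ∞`" for `κ ≥ 8` (Rohde–Schramm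
(2005), p. 905–906). [cite: RohdeSchramm2005, Lemma 6.3] -/
theorem hypHalf_ge (hη : 1 / 4 ≤ η) (hη' : η ≤ 1 / 2) {r : ℝ} (hr0 : 0 ≤ r) (hr : r < 1) :
    1 + 2 * η ^ 2 * (-Real.log (1 - r)) ≤ ₂F₁ η η (1 / 2 : ℝ) r := by
  have hη0 : 0 < η := by linarith
  have hF := hasSum_hypHalf hη0 hη' hr0 hr
  -- the tail `Σ_{n ≥ 1}`
  have htail : HasSum (fun n ↦ hypHalfCoeff η (n + 1) * r ^ (n + 1))
      (₂F₁ η η (1 / 2 : ℝ) r - 1) := by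
    have := (hasSum_nat_add_iff' 1).2 hF
    simpa [hypHalfCoeff_zero] using this
  have hlog : HasSum (fun n : ℕ ↦ 2 * η ^ 2 * (r ^ (n + 1) / (n + 1)))
      (2 * η ^ 2 * (-Real.log (1 - r))) :=
    (Real.hasSum_pow_div_log_of_abs_lt_one (by rwa [abs_of_nonneg hr0])).mul_left _
  have hle : ∀ n : ℕ, 2 * η ^ 2 * (r ^ (n + 1) / (n + 1)) ≤ hypHalfCoeff η (n + 1) * r ^ (n + 1) := by
    intro n
    have hc := mul_hypHalfCoeff_ge hη (n + 1) (Nat.succ_le_succ (Nat.zero_le n))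
    rw [Nat.cast_succ] at hc
    have hn : (0 : ℝ) < n + 1 := by positivity
    rw [mul_div_assoc', div_le_iff₀ hn]
    calc 2 * η ^ 2 * r ^ (n + 1) ≤ (n + 1) * hypHalfCoeff η (n + 1) * r ^ (n + 1) :=
          mul_le_mul_of_nonneg_right hc (pow_nonneg hr0 _)
      _ = hypHalfCoeff η (n + 1) * r ^ (n + 1) * (n + 1) := by ring
  have := hasSum_le hle hlog htail
  linarith

end HypHalf

/-! ### `Ĝ` as a function of the slope `w = x/y` -/

/-- **`Ĝ` along the slope**: `rsGhatW κ w := ₂F₁(η(κ), η(κ), 1/2, w²/(1+w²))`, the value of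
`Ĝ_{a(κ),κ}` at a point with `x/y = w` (`rsGhat_rsExponent_eq`). [cite: RohdeSchramm2005, Lemma 6.3] -/
def rsGhatW (κ w : ℝ) : ℝ :=
  ₂F₁ (rsEta κ) (rsEta κ) (1 / 2 : ℝ) (w ^ 2 / (1 + w ^ 2))

/-- `0 ≤ w²/(1+w²) < 1`. [folklore] -/
theorem slopeArg_nonneg (w : ℝ) : 0 ≤ w ^ 2 / (1 + w ^ 2) := by positivity

/-- `w²/(1+w²) < 1`. [folklore] -/
theorem slopeArg_lt_one (w : ℝ) : w ^ 2 / (1 + w ^ 2) < 1 := by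
  rw [div_lt_one (by positivity)]; linarith

/-- `w²/(1+w²)` is non-decreasing in `|w|`. [folklore] -/
theorem slopeArg_mono {w s : ℝ} (h : |w| ≤ s) : w ^ 2 / (1 + w ^ 2) ≤ s ^ 2 / (1 + s ^ 2) := by
  have hw2 : w ^ 2 ≤ s ^ 2 := by
    calc w ^ 2 = |w| ^ 2 := (sq_abs _).symm
      _ ≤ s ^ 2 := pow_le_pow_left₀ (abs_nonneg _) h 2
  rw [div_le_div_iff₀ (by positivity) (by positivity)]
  nlinarith

/-- `1 - s²/(1+s²) = 1/(1+s²)`, so `-log(1 - s²/(1+s²)) = log(1+s²)`. [folklore] -/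
theorem neg_log_one_sub_slopeArg (s : ℝ) :
    -Real.log (1 - s ^ 2 / (1 + s ^ 2)) = Real.log (1 + s ^ 2) := by
  have h1 : (0 : ℝ) < 1 + s ^ 2 := by positivity
  rw [show 1 - s ^ 2 / (1 + s ^ 2) = (1 + s ^ 2)⁻¹ by field_simp; ring, Real.log_inv, neg_neg]

/-- **`Ĝ_{a(κ),κ}(z) = ₂F₁(η, η, 1/2, w²/(1+w²))`, `w = Re z / Im z`**, for `Im z ≠ 0`, `κ ≠ 0`.
[cite: RohdeSchramm2005, Lemma 6.3] -/
theorem rsGhat_rsExponent_eq {κ : ℝ} (hκ : κ ≠ 0) {Z : ℂ} (hZ : Z.im ≠ 0) :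
    rsGhat (rsExponent κ) κ Z = rsGhatW κ (Z.re / Z.im) := by
  rw [rsGhat, rsEta₀_rsExponent hκ, rsEta₁_rsExponent hκ, re_sq_div_eq hZ, rsGhatW]

/-- `rsGhatW` is even in `w` (it depends on `w²`). [folklore] -/
theorem rsGhatW_neg (κ w : ℝ) : rsGhatW κ (-w) = rsGhatW κ w := by
  simp [rsGhatW]

/-- `rsGhatW κ w = rsGhatW κ |w|`. [folklore] -/
theorem rsGhatW_abs (κ w : ℝ) : rsGhatW κ |w| = rsGhatW κ w := by
  simp [rsGhatW, sq_abs]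

/-- At `w = 0` (the point `i`): `Ĝ(i) = 1` ("Note that `Ĝ(i) = 1`", p. 905). [cite: RohdeSchramm2005, Lemma 6.3] -/
theorem rsGhatW_zero (κ : ℝ) : rsGhatW κ 0 = 1 := by
  simp [rsGhatW]

/-- `1 ≤ rsGhatW κ w` for `κ ≥ 8`. [folklore] -/
theorem one_le_rsGhatW {κ : ℝ} (hκ : 8 ≤ κ) (w : ℝ) : 1 ≤ rsGhatW κ w :=
  one_le_hypHalf (by linarith [one_quarter_le_rsEta hκ]) (rsEta_lt_half (by linarith)).le
    (slopeArg_nonneg w) (slopeArg_lt_one w)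

/-- `0 < rsGhatW κ w` for `κ ≥ 8` ("`Ĝ(x + i) > 0` for every `x ∈ ℝ`", p. 905, here immediate).
[cite: RohdeSchramm2005, Lemma 6.3] -/
theorem rsGhatW_pos {κ : ℝ} (hκ : 8 ≤ κ) (w : ℝ) : 0 < rsGhatW κ w :=
  one_pos.trans_le (one_le_rsGhatW hκ w)

/-- **Monotonicity in `|w|`**: `|w| ≤ s → rsGhatW κ w ≤ rsGhatW κ s` (`κ ≥ 8`) — "`Ĝ(z_{t∧T})` is
bounded" (p. 905). [cite: RohdeSchramm2005, Lemma 6.3] -/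
theorem rsGhatW_le_of_abs_le {κ : ℝ} (hκ : 8 ≤ κ) {w s : ℝ} (h : |w| ≤ s) :
    rsGhatW κ w ≤ rsGhatW κ s :=
  hypHalf_mono (by linarith [one_quarter_le_rsEta hκ]) (rsEta_lt_half (by linarith)).le
    (slopeArg_nonneg w) (slopeArg_mono h) (slopeArg_lt_one s)

/-- **`Ĝ(s + i) ≥ 1 + 2η² log(1 + s²)`** for `κ ≥ 8` (`η = 1/2 - 2/κ ≥ 1/4`).
[cite: RohdeSchramm2005, Lemma 6.3] -/
theorem rsGhatW_ge_log {κ : ℝ} (hκ : 8 ≤ κ) (s : ℝ) :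
    1 + 2 * rsEta κ ^ 2 * Real.log (1 + s ^ 2) ≤ rsGhatW κ s := by
  have := hypHalf_ge (one_quarter_le_rsEta hκ) (rsEta_lt_half (by linarith)).le
    (slopeArg_nonneg s) (slopeArg_lt_one s)
  rwa [neg_log_one_sub_slopeArg] at this

/-- **`Ĝ(1) = ∞` for `κ ≥ 8`**: `rsGhatW κ s → ∞` as `s → ∞` (Rohde–Schramm (2005), p. 905–906:
"`Ĝ(1) = ∞` if `κ > 8`", "`Ĝ_{·,8}(1) = ∞`"). [cite: RohdeSchramm2005, Lemma 6.3] -/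
theorem tendsto_rsGhatW_atTop {κ : ℝ} (hκ : 8 ≤ κ) : Tendsto (rsGhatW κ) atTop atTop := by
  have hη : 0 < 2 * rsEta κ ^ 2 := by
    have := one_quarter_le_rsEta hκ
    positivity
  refine tendsto_atTop_mono (rsGhatW_ge_log hκ) ?_
  have h1 : Tendsto (fun s : ℝ ↦ 1 + s ^ 2) atTop atTop :=
    tendsto_atTop_add_const_left _ _ (tendsto_pow_atTop two_ne_zero)
  have h2 : Tendsto (fun s : ℝ ↦ Real.log (1 + s ^ 2)) atTop atTop := Real.tendsto_log_atTop.comp h1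
  exact tendsto_atTop_add_const_left _ _ (h2.const_mul_atTop hη)

end Literature.Probability.RandomPlanarGeometry

end
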